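import Summits.Ventures.PackingBounds.Energy.FivePointRieszThreeQuad
import Summits.Ventures.PackingBounds.Energy.FivePointRieszThreeGramFacts
import Summits.Ventures.PackingBounds.Energy.GramListQuad
import HarnessLib

/-!
# `FivePointRieszThree`, `d = 6`: the explicit Gram form is nonnegative (bridge to the kernel-checked integer data)

Framing: lottery ticket; floor = certified bounds/negative ranges. Venture `PackingBounds`, cell
`pub-packcert`, energy family E3PT (pub-packcert-energy gen 12; KERNEL-D6 data route).

`quad_bridgeR3`: `S · quad_1R3 y = listQuad y yQ 0 + S · pk_1R3 y` (structural `simp` over the data rows + `ring` on a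
`ℚ(√2,√3)`-linear combination of the atoms `y i · y j`); with `GramData.listQuad_eq_sum_ent`, `GramData.psd_of_checks` on the kernel-checked facts `RieszThreeD6.rowsQ_all` / `ddQ_all`
and `pk_1_nonnegR3` this gives `quad_1_nonnegR3 : 0 ≤ quad_1R3 y` — the PSD of the `77 × 77` block without a `ring` Gram factorisation.
-/

noncomputable section

namespace Summit.Ventures.PackingBounds.Energy.FivePointRieszThree

open Summit.Ventures.PackingBounds.Energy.GramData Summit.Ventures.PackingBounds.Energy.RieszThreeD6

set_option maxRecDepth 100000 in
set_option maxHeartbeats 400000000 in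
/-- The explicit Gram form, scaled by `S`, is the list-structural quadratic form of the integer data `yQ` plus `S` times the `ℚ(√2,√3)`-part. -/
theorem quad_bridgeR3 (y : ℕ → ℝ) : (scaleQ : ℝ) * quad_1R3 y = listQuad y yQ 0 + (scaleQ : ℝ) * pk_1R3 y := by
  simp only [listQuad, rowQuad, yQ, yQ0, yQ1, yQ2, yQ3, yQ4, yQ5, yQ6, yQ7, yQ8, yQ9, yQ10, yQ11, yQ12, yQ13, yQ14, yQ15, yQ16, yQ17, yQ18, yQ19, yQ20, yQ21, yQ22, yQ23, yQ24, yQ25, yQ26, yQ27, yQ28, yQ29, yQ30, yQ31, yQ32, yQ33, yQ34, yQ35, yQ36, yQ37, yQ38, yQ39, yQ40, yQ41, yQ42, yQ43, yQ44, yQ45, yQ46, yQ47, yQ48, yQ49, yQ50, yQ51, yQ52, yQ53, yQ54, yQ55, yQ56, yQ57, yQ58, yQ59, yQ60, yQ61, yQ62, yQ63, yQ64, yQ65, yQ66, yQ67, yQ68, yQ69, yQ70, yQ71, yQ72, yQ73, yQ74, yQ75, yQ76, scaleQ, Nat.reduceAdd]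
  unfold quad_1R3 quad_1_0R3 quad_1_1R3 quad_1_2R3 quad_1_3R3 quad_1_4R3 quad_1_5R3 quad_1_6R3 quad_1_7R3 quad_1_8R3 quad_1_9R3 pk_1R3
  push_cast
  ring

set_option maxRecDepth 100000 in
/-- **The `77 × 77` Gram block of the certificate is positive semidefinite**: `quad_1R3 y ≥ 0` for every `y` (the rational part by
`GramData.psd_of_checks` on the kernel-checked integer data `rowsQ_all` / `ddQ_all`, the `ℚ(√2,√3)`-part by `pk_1_nonnegR3`). -/
theorem quad_1_nonnegR3 (y : ℕ → ℝ) : 0 ≤ quad_1R3 y := by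
  have hS : (0 : ℝ) < (scaleQ : ℝ) := by unfold scaleQ; norm_num
  have hlen : yQ.length = 77 := by decide
  have hrow : ∀ m, m < 77 → (yQ.getD m []).length = 77 := by decide +kernel
  have h := psd_of_checks 77 77 yQ lQ eQ rowsQ_all (of_checkDD ddQ_all) (fun i : Fin 77 => y i)
  rw [← listQuad_eq_sum_ent y yQ 77 hlen hrow] at h
  have hpk := pk_1_nonnegR3 y
  have h2 : 0 ≤ (scaleQ : ℝ) * quad_1R3 y := by rw [quad_bridgeR3]; exact add_nonneg h (mul_nonneg hS.le hpk)
  exact (mul_nonneg_iff_of_pos_left hS).1 h2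

end Summit.Ventures.PackingBounds.Energy.FivePointRieszThree
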